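import Summits.AtomisticToContinuum.Crystallization.Theorems.FrustratedLawDichotomyTwoShellRigidityCells
import Summits.AtomisticToContinuum.Crystallization.Theorems.FrustratedLawDichotomyCappedRigidityCertPatterns

/-!
# FrustratedLawDichotomy · crux `AperiodicFrustratedLawGap` (stmt-AtomisticToContinuum-27623) — lens-5 g30's piece `Extraction θ` PROVED
# (decomp-a2c, prover hand 2, gen 9)

`FrustratedLawDichotomyTwoShellRigidityCells` (lens-5 g30 node) splits `R = CoarseCappedRigidity K θ` as
`Extraction θ ∧ CellLemmas K c ⟹ R` (`coarseCappedRigidity_of_cells`), where `ExtractionAt θ Pat` is the bond-graph bookkeeping that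
feeds the cells: `nn_i > 0`; radii in `[nn_i, (1+θ)·nn_i]`; contact pairs in `[nn_i/(1+θ), (1+θ)²·nn_i]`; distinct non-contact pairs
`≥ nn_i`; every `√2`-pair has a cap position with its four cap bonds in `[nn_i/(1+θ), (1+θ)²·nn_i]` and norm `≥ nn_i/(1+θ)`.

This def-free file PROVES it, for every `θ ≥ 0` and every nonempty pattern whose contact graph separates points (the fcc and the hcp kissing
patterns do: `fcc_contactSeparating`, `hcp_contactSeparating`):

* `extractionAt_of_contactSeparating : 0 ≤ θ → Pat.Nonempty → (contact separation) → ExtractionAt θ Pat`;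
* `extraction_holds : 0 ≤ θ → Extraction θ`;
* hence lens-5's R needs the CELL LEMMAS only: `coarseCappedRigidity_of_cellLemmas : 0 < θ ≤ 1/100 → CellLemmas K c → CoarseCappedRigidity K θ`,
  `uniformCoarseCappedRigidity_of_cellLemmas : CellLemmas K c → UniformCoarseCappedRigidity K`, and
  `cappedRigidity_of_cellLemmas_of_basin : CellLemmas K c → BasinCertificate K θ η → CappedRigidity θ η (= M)`.
Every clause is two lines of `bondGraph_adj` / `nearestDist_le_dist` arithmetic (the same extraction as in
`FrustratedLawDichotomyCappedRigidityCert.cappedRigidityAt_of_cert`, unscaled).  `[folklore]`; no definitions, no `sorry`.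
-/

noncomputable section

namespace Summit.AtomisticToContinuum.Crystallization.Theorems.FrustratedLawDichotomyTwoShellRigidityExtraction

open Literature.Geometry.DiscreteGeometry
open Summit.AtomisticToContinuum.Crystallization.Theorems.FrustratedLawDichotomyTwoShellRigidityCut
  (E3 LinkIso Capped CappedRigidity)
open Summit.AtomisticToContinuum.Crystallization.Theorems.FrustratedLawDichotomyTwoShellRigidityCells
  (ExtractionAt Extraction CellLemmas CoarseCappedRigidity UniformCoarseCappedRigidity BasinCertificate
    coarseCappedRigidity_of_cells cappedRigidity_of_coarse_of_basin)
open Summit.AtomisticToContinuum.Crystallization.Theorems.FrustratedLawDichotomyCappedRigidityCertPatterns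
  (fcc_contactSeparating hcp_contactSeparating)

/-- **`ExtractionAt θ Pat` holds** for every `θ ≥ 0` and every nonempty pattern whose contact graph separates points. [folklore] -/
theorem extractionAt_of_contactSeparating {θ : ℝ} {Pat : Finset E3} (hθ0 : 0 ≤ θ) (hne : Pat.Nonempty)
    (hPat : ∀ u v : ↥Pat, u ≠ v → ∃ w : ↥Pat, dist (u : E3) (w : E3) = 1 ∧ dist (v : E3) (w : E3) ≠ 1) :
    ExtractionAt θ Pat := by
  classical
  intro N y i τ hy _hsep hL hC
  obtain ⟨u₀, hu₀⟩ := hne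
  have hadj : ∀ {j k : Fin N}, (bondGraph θ y).Adj j k ↔
      j ≠ k ∧ dist (y j) (y k) ≤ (1 + θ) * min (nearestDist y j) (nearestDist y k) :=
    fun {j k} => bondGraph_adj
  have hθ : 0 ≤ 1 + θ := by linarith
  have hθ1 : (1 : ℝ) ≤ 1 + θ := by linarith
  have hθpos : 0 < 1 + θ := by linarith
  have hτi : ∀ u, τ u ≠ i := fun u h => (hL.1 u).ne h.symm
  -- `r = nn_i > 0`
  obtain ⟨k₀, hk₀, hr⟩ := exists_nearestDist_eq_dist y (j := i) ⟨τ ⟨u₀, hu₀⟩, hτi ⟨u₀, hu₀⟩⟩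
  set r : ℝ := nearestDist y i with hr_def
  have hr0 : 0 < r := by
    rw [hr]
    exact dist_pos.2 fun h => hk₀ (hy h).symm
  -- radial facts
  have hrad_lo : ∀ j, j ≠ i → r ≤ dist (y j) (y i) := by
    intro j hj
    rw [dist_comm]
    exact nearestDist_le_dist y hj
  have hrad_hi : ∀ j, (bondGraph θ y).Adj i j → dist (y j) (y i) ≤ (1 + θ) * r := by
    intro j hj
    obtain ⟨-, hle⟩ := hadj.1 hj
    rw [dist_comm]
    exact hle.trans (mul_le_mul_of_nonneg_left (min_le_left _ _) hθ)
  -- the own scale of a neighbour `j` of `i`: `r/(1+θ) ≤ nd j ≤ (1+θ)·r`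
  have hnd_lo : ∀ j, (bondGraph θ y).Adj i j → r / (1 + θ) ≤ nearestDist y j := by
    intro j hj
    obtain ⟨hne, hle⟩ := hadj.1 hj
    rw [div_le_iff₀ hθpos]
    have h1 : dist (y i) (y j) ≤ (1 + θ) * nearestDist y j :=
      hle.trans (mul_le_mul_of_nonneg_left (min_le_right _ _) hθ)
    have h2 : r ≤ dist (y i) (y j) := nearestDist_le_dist y hne.symm
    linarith
  have hnd_hi : ∀ j, (bondGraph θ y).Adj i j → nearestDist y j ≤ (1 + θ) * r := fun j hj =>
    (nearestDist_le_dist y hj.ne).trans (hrad_hi j hj)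
  -- a bond `j ∼ k` at a neighbour `j` of `i`: `r/(1+θ) ≤ dist (y j) (y k) ≤ (1+θ)²·r`
  have hbond : ∀ j k, (bondGraph θ y).Adj i j → (bondGraph θ y).Adj j k →
      r / (1 + θ) ≤ dist (y j) (y k) ∧ dist (y j) (y k) ≤ (1 + θ) ^ 2 * r := by
    intro j k hij hjk
    obtain ⟨hne, hle⟩ := hadj.1 hjk
    refine ⟨(hnd_lo j hij).trans (nearestDist_le_dist y hne.symm), ?_⟩
    have h1 : dist (y j) (y k) ≤ (1 + θ) * nearestDist y j :=
      hle.trans (mul_le_mul_of_nonneg_left (min_le_left _ _) hθ)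
    have h2 := mul_le_mul_of_nonneg_left (hnd_hi j hij) hθ
    calc dist (y j) (y k) ≤ (1 + θ) * nearestDist y j := h1
      _ ≤ (1 + θ) * ((1 + θ) * r) := h2
      _ = (1 + θ) ^ 2 * r := by ring
  -- `τ` is injective (the contact graph of `Pat` separates points)
  have hτ : Function.Injective τ := by
    intro u v huv
    by_contra hne
    obtain ⟨w, huw, hvw⟩ := hPat u v hne
    have h1 : (bondGraph θ y).Adj (τ u) (τ w) := (hL.2.2 u w).2 huw
    rw [huv] at h1
    exact hvw ((hL.2.2 v w).1 h1)
  refine ⟨hr0, fun u => ?_, fun u w huw => ?_, fun u v huv hd => ?_, fun u v huv => ?_⟩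
  · -- radii
    rw [← dist_eq_norm]
    exact ⟨hrad_lo _ (hτi u), hrad_hi _ (hL.1 u)⟩
  · -- contact pairs
    rw [dist_sub_right]
    exact hbond (τ u) (τ w) (hL.1 u) ((hL.2.2 u w).2 huw)
  · -- distinct non-contact pairs are genuine non-bonds, `> r`
    rw [dist_sub_right]
    have hjk : τ u ≠ τ v := hτ.ne huv
    have hnot : ¬ (bondGraph θ y).Adj (τ u) (τ v) := fun h => hd ((hL.2.2 u v).1 h)
    have hgt : (1 + θ) * min (nearestDist y (τ u)) (nearestDist y (τ v)) < dist (y (τ u)) (y (τ v)) := by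
      by_contra hle
      exact hnot (hadj.2 ⟨hjk, not_lt.1 hle⟩)
    obtain ⟨-, hu⟩ := hadj.1 (hL.1 u)
    obtain ⟨-, hv⟩ := hadj.1 (hL.1 v)
    have hu' : r ≤ (1 + θ) * nearestDist y (τ u) :=
      (nearestDist_le_dist y (hτi u)).trans (hu.trans (mul_le_mul_of_nonneg_left (min_le_right _ _) hθ))
    have hv' : r ≤ (1 + θ) * nearestDist y (τ v) :=
      (nearestDist_le_dist y (hτi v)).trans (hv.trans (mul_le_mul_of_nonneg_left (min_le_right _ _) hθ))
    have hmin : r ≤ (1 + θ) * min (nearestDist y (τ u)) (nearestDist y (τ v)) := by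
      rw [mul_min_of_nonneg _ _ hθ]
      exact le_min hu' hv'
    exact (hmin.trans hgt.le)
  · -- caps
    obtain ⟨m, hmi, hbonds⟩ := hC u v huv
    refine ⟨y m - y i, fun z hz => ?_, ?_⟩
    · rw [dist_sub_right, dist_comm]
      have hmz : (bondGraph θ y).Adj (τ z) m := (hbonds z hz).symm
      exact hbond (τ z) m (hL.1 z) hmz
    · rw [← dist_eq_norm]
      exact (div_le_self hr0.le hθ1).trans (hrad_lo m hmi)

/-- **`Extraction θ` holds for every `θ ≥ 0`** (both kissing patterns are nonempty and their contact graphs separate points). [folklore] -/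
theorem extraction_holds {θ : ℝ} (hθ0 : 0 ≤ θ) : Extraction θ := by
  have hf : fccKissingPattern.Nonempty := Finset.card_pos.1 (by rw [card_fccKissingPattern]; norm_num)
  have hh : hcpKissingPattern.Nonempty := Finset.card_pos.1 (by rw [card_hcpKissingPattern]; norm_num)
  exact ⟨extractionAt_of_contactSeparating hθ0 hf fcc_contactSeparating,
    extractionAt_of_contactSeparating hθ0 hh hcp_contactSeparating⟩

/-- **lens-5's R from the cell lemmas ALONE**: `0 < θ ≤ 1/100 → CellLemmas K c → CoarseCappedRigidity K θ`. [folklore] -/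
theorem coarseCappedRigidity_of_cellLemmas {K c θ : ℝ} (hθ0 : 0 < θ) (hθ1 : θ ≤ 1 / 100) (hcells : CellLemmas K c) :
    CoarseCappedRigidity K θ :=
  coarseCappedRigidity_of_cells hθ0 hθ1 (extraction_holds hθ0.le) hcells

/-- **R uniformly on the dial from the cell lemmas alone**: `CellLemmas K c → UniformCoarseCappedRigidity K`. [folklore] -/
theorem uniformCoarseCappedRigidity_of_cellLemmas {K c : ℝ} (hcells : CellLemmas K c) : UniformCoarseCappedRigidity K :=
  fun _θ hθ0 hθ1 => coarseCappedRigidity_of_cellLemmas hθ0 hθ1 hcells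

/-- **M from the cell lemmas and the basin certificate**: `0 < θ ≤ 1/100 → CellLemmas K c → BasinCertificate K θ η → CappedRigidity θ η`.
[folklore] -/
theorem cappedRigidity_of_cellLemmas_of_basin {K c θ η : ℝ} (hθ0 : 0 < θ) (hθ1 : θ ≤ 1 / 100) (hcells : CellLemmas K c)
    (hL : BasinCertificate K θ η) : CappedRigidity θ η :=
  cappedRigidity_of_coarse_of_basin (coarseCappedRigidity_of_cellLemmas hθ0 hθ1 hcells) hL

/-- **The FLD column by name with `Extraction` discharged**: `MuEquilibriumDoor ∧ ChargedEnergyGap ∧ G(1/100) ∧ P(1/100) ∧ CellLemmas K c ∧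
BasinCertificate K (1/100) (1/20) ⟹ AperiodicFrustratedLawGap` (crux of item 27623). [folklore] -/
theorem aperiodicFrustratedLawGap_of_cellLemmas_of_basin {K c : ℝ}
    (hDoor : Summit.AtomisticToContinuum.Crystallization.Theses.GrainCoreNetworkSplit.MuEquilibriumDoor)
    (hgap : Summit.AtomisticToContinuum.Crystallization.Theses.PricedLinkCensus.ChargedEnergyGap)
    (hG : Summit.AtomisticToContinuum.Crystallization.Theorems.FrustratedLawDichotomyTwoShellRigidityCut.LinkClassification (1 / 100))
    (hP : Summit.AtomisticToContinuum.Crystallization.Theorems.FrustratedLawDichotomyTwoShellRigidityCut.CapForcing (1 / 100))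
    (hcells : CellLemmas K c) (hL : BasinCertificate K (1 / 100) (1 / 20)) :
    Summit.AtomisticToContinuum.Crystallization.Theses.FrustratedLawDichotomy.AperiodicFrustratedLawGap :=
  Summit.AtomisticToContinuum.Crystallization.Theorems.FrustratedLawDichotomyTwoShellRigidityCut.aperiodicFrustratedLawGap_of_cut
    hDoor hgap hG hP (cappedRigidity_of_cellLemmas_of_basin (by norm_num) le_rfl hcells hL)

/-- **Item 26654 `NoFrustratedPeriodicMinimiser`, door-free, with `Extraction` discharged**: `ChargedEnergyGap ∧ G ∧ P ∧ CellLemmas K c ∧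
BasinCertificate K (1/100) (1/20) ⟹ NoFrustratedPeriodicMinimiser`. [folklore] -/
theorem noFrustratedPeriodicMinimiser_of_cellLemmas_of_basin {K c : ℝ}
    (hgap : Summit.AtomisticToContinuum.Crystallization.Theses.PricedLinkCensus.ChargedEnergyGap)
    (hG : Summit.AtomisticToContinuum.Crystallization.Theorems.FrustratedLawDichotomyTwoShellRigidityCut.LinkClassification (1 / 100))
    (hP : Summit.AtomisticToContinuum.Crystallization.Theorems.FrustratedLawDichotomyTwoShellRigidityCut.CapForcing (1 / 100))
    (hcells : CellLemmas K c) (hL : BasinCertificate K (1 / 100) (1 / 20)) :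
    Summit.AtomisticToContinuum.Crystallization.Theses.PeriodicChargeSplit.NoFrustratedPeriodicMinimiser :=
  Summit.AtomisticToContinuum.Crystallization.Theorems.FrustratedLawDichotomyTwoShellRigidityCut.noFrustratedPeriodicMinimiser_of_cut
    hgap hG hP (cappedRigidity_of_cellLemmas_of_basin (by norm_num) le_rfl hcells hL)

end Summit.AtomisticToContinuum.Crystallization.Theorems.FrustratedLawDichotomyTwoShellRigidityExtraction

end
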